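import Mathlib

/-!
# Piece (H) of the 8-point code bound: small graphs have `rank (2I + A) ≥ n − 1`

For the adjacency matrix `A` of a graph on `n ≤ 5` vertices the matrix `2I + A` has a nonsingular
principal submatrix of size `n − 1` (size `n` for `n = 3`): a kernel computation over the 1,024
labelled graphs on five vertices (sixteen chunks of 64), the 64 graphs on four vertices and the 8 on
three. Graphs are given by their edge-indicator functions (`Fin 10 → Bool` etc.); the chunks run over
bit patterns of numbers and `testBit_pattern10` shows every indicator function is such a pattern.
Consequence (`HOME/proofs/P4-seven.md` §9.2): a family of `m` balanced 4-subsets of an 8-set with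
pairwise intersections in `{2, 3}` — Gram matrix `4 (2I + A)` with `A` the «meet in 3» graph — spans
a space of dimension `≥ 3` for `m ≥ 3` and `≥ 4` for `m ≥ 5` (rank of a symmetric matrix is attained
on a principal submatrix; principal submatrices of principal submatrices are principal submatrices).
-/

namespace PercRepro

/-- Edge `k` of `K₅` (`k < 10`) as an index pair. -/
def edges5 : Fin 10 → Fin 5 × Fin 5 :=
  ![(0,1),(0,2),(0,3),(0,4),(1,2),(1,3),(1,4),(2,3),(2,4),(3,4)]

/-- The edge index of the pair `{i, j}` in `K₅` (`0` on the diagonal, never used there). -/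
def eidx5 : Fin 5 → Fin 5 → Fin 10 :=
  ![![0, 0, 1, 2, 3], ![0, 0, 4, 5, 6], ![1, 4, 0, 7, 8], ![2, 5, 7, 0, 9], ![3, 6, 8, 9, 0]]

/-- Adjacency of the graph on five vertices with edge indicator `b`. -/
def adj5 (b : Fin 10 → Bool) (i j : Fin 5) : ℤ :=
  if i = j then 0 else if b (eidx5 i j) then 1 else 0

/-- `2I + A` with vertex `v` deleted (a `4 × 4` principal submatrix). -/
def minor5 (b : Fin 10 → Bool) (v : Fin 5) : Matrix (Fin 4) (Fin 4) ℤ :=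
  Matrix.of fun i j => (if i = j then 2 else 0) + adj5 b (v.succAbove i) (v.succAbove j)

/-- The ten low bits of a number, as an edge indicator. -/
def bits10 (n : ℕ) : Fin 10 → Bool := fun k => n.testBit k.val

/-- The number whose ten low bits are `b`. -/
def pattern10 (b : Fin 10 → Bool) : ℕ :=
  (List.finRange 10).foldr (fun k acc => (if b k then 2 ^ k.val else 0) ||| acc) 0

set_option maxRecDepth 100000 in
/-- Reading the ten bits of a pattern number back gives the number. -/
theorem bits10_pattern10 : ∀ b : Fin 10 → Bool, bits10 (pattern10 b) = b := by
  decide +kernel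

set_option maxRecDepth 100000 in
/-- The pattern number of ten bits is below `1024`. -/
theorem pattern10_lt : ∀ b : Fin 10 → Bool, pattern10 b < 1024 := by
  decide +kernel

/-- Edge `k` of `K₄` (`k < 6`). -/
def edges4 : Fin 6 → Fin 4 × Fin 4 := ![(0,1),(0,2),(0,3),(1,2),(1,3),(2,3)]

/-- The edge index of `{i, j}` in `K₄`. -/
def eidx4 : Fin 4 → Fin 4 → Fin 6 := ![![0, 0, 1, 2], ![0, 0, 3, 4], ![1, 3, 0, 5], ![2, 4, 5, 0]]

/-- Adjacency of the graph on four vertices with edge indicator `b`. -/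
def adj4 (b : Fin 6 → Bool) (i j : Fin 4) : ℤ :=
  if i = j then 0 else if b (eidx4 i j) then 1 else 0

/-- `2I + A` on four vertices with vertex `v` deleted. -/
def minor4 (b : Fin 6 → Bool) (v : Fin 4) : Matrix (Fin 3) (Fin 3) ℤ :=
  Matrix.of fun i j => (if i = j then 2 else 0) + adj4 b (v.succAbove i) (v.succAbove j)

/-- Edge `k` of `K₃`. -/
def edges3 : Fin 3 → Fin 3 × Fin 3 := ![(0,1),(0,2),(1,2)]

/-- The edge index of `{i, j}` in `K₃`. -/
def eidx3 : Fin 3 → Fin 3 → Fin 3 := ![![0, 0, 1], ![0, 0, 2], ![1, 2, 0]]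

/-- Adjacency of the graph on three vertices with edge indicator `b`. -/
def adj3 (b : Fin 3 → Bool) (i j : Fin 3) : ℤ :=
  if i = j then 0 else if b (eidx3 i j) then 1 else 0

/-- `2I + A` on three vertices. -/
def full3 (b : Fin 3 → Bool) : Matrix (Fin 3) (Fin 3) ℤ :=
  Matrix.of fun i j => (if i = j then 2 else 0) + adj3 b i j

set_option maxRecDepth 100000 in
/-- Chunk 0 of `rank5_all`: the sixty-four bit patterns `0` to `63` (kernel computation). -/
theorem rank5_chunk0 : ∀ n : Fin 64, ∃ v : Fin 5, (minor5 (bits10 (0 + n.val)) v).det ≠ 0 := by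
  decide +kernel

set_option maxRecDepth 100000 in
/-- Chunk 1 of `rank5_all`: the sixty-four bit patterns `64` to `127` (kernel computation). -/
theorem rank5_chunk1 : ∀ n : Fin 64, ∃ v : Fin 5, (minor5 (bits10 (64 + n.val)) v).det ≠ 0 := by
  decide +kernel

set_option maxRecDepth 100000 in
/-- Chunk 2 of `rank5_all`: the sixty-four bit patterns `128` to `191` (kernel computation). -/
theorem rank5_chunk2 : ∀ n : Fin 64, ∃ v : Fin 5, (minor5 (bits10 (128 + n.val)) v).det ≠ 0 := by
  decide +kernel

set_option maxRecDepth 100000 in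
/-- Chunk 3 of `rank5_all`: the sixty-four bit patterns `192` to `255` (kernel computation). -/
theorem rank5_chunk3 : ∀ n : Fin 64, ∃ v : Fin 5, (minor5 (bits10 (192 + n.val)) v).det ≠ 0 := by
  decide +kernel

set_option maxRecDepth 100000 in
/-- Chunk 4 of `rank5_all`: the sixty-four bit patterns `256` to `319` (kernel computation). -/
theorem rank5_chunk4 : ∀ n : Fin 64, ∃ v : Fin 5, (minor5 (bits10 (256 + n.val)) v).det ≠ 0 := by
  decide +kernel

set_option maxRecDepth 100000 in
/-- Chunk 5 of `rank5_all`: the sixty-four bit patterns `320` to `383` (kernel computation). -/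
theorem rank5_chunk5 : ∀ n : Fin 64, ∃ v : Fin 5, (minor5 (bits10 (320 + n.val)) v).det ≠ 0 := by
  decide +kernel

set_option maxRecDepth 100000 in
/-- Chunk 6 of `rank5_all`: the sixty-four bit patterns `384` to `447` (kernel computation). -/
theorem rank5_chunk6 : ∀ n : Fin 64, ∃ v : Fin 5, (minor5 (bits10 (384 + n.val)) v).det ≠ 0 := by
  decide +kernel

set_option maxRecDepth 100000 in
/-- Chunk 7 of `rank5_all`: the sixty-four bit patterns `448` to `511` (kernel computation). -/
theorem rank5_chunk7 : ∀ n : Fin 64, ∃ v : Fin 5, (minor5 (bits10 (448 + n.val)) v).det ≠ 0 := by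
  decide +kernel

set_option maxRecDepth 100000 in
/-- Chunk 8 of `rank5_all`: the sixty-four bit patterns `512` to `575` (kernel computation). -/
theorem rank5_chunk8 : ∀ n : Fin 64, ∃ v : Fin 5, (minor5 (bits10 (512 + n.val)) v).det ≠ 0 := by
  decide +kernel

set_option maxRecDepth 100000 in
/-- Chunk 9 of `rank5_all`: the sixty-four bit patterns `576` to `639` (kernel computation). -/
theorem rank5_chunk9 : ∀ n : Fin 64, ∃ v : Fin 5, (minor5 (bits10 (576 + n.val)) v).det ≠ 0 := by
  decide +kernel

set_option maxRecDepth 100000 in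
/-- Chunk 10 of `rank5_all`: the sixty-four bit patterns `640` to `703` (kernel computation). -/
theorem rank5_chunk10 : ∀ n : Fin 64, ∃ v : Fin 5, (minor5 (bits10 (640 + n.val)) v).det ≠ 0 := by
  decide +kernel

set_option maxRecDepth 100000 in
/-- Chunk 11 of `rank5_all`: the sixty-four bit patterns `704` to `767` (kernel computation). -/
theorem rank5_chunk11 : ∀ n : Fin 64, ∃ v : Fin 5, (minor5 (bits10 (704 + n.val)) v).det ≠ 0 := by
  decide +kernel

set_option maxRecDepth 100000 in
/-- Chunk 12 of `rank5_all`: the sixty-four bit patterns `768` to `831` (kernel computation). -/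
theorem rank5_chunk12 : ∀ n : Fin 64, ∃ v : Fin 5, (minor5 (bits10 (768 + n.val)) v).det ≠ 0 := by
  decide +kernel

set_option maxRecDepth 100000 in
/-- Chunk 13 of `rank5_all`: the sixty-four bit patterns `832` to `895` (kernel computation). -/
theorem rank5_chunk13 : ∀ n : Fin 64, ∃ v : Fin 5, (minor5 (bits10 (832 + n.val)) v).det ≠ 0 := by
  decide +kernel

set_option maxRecDepth 100000 in
/-- Chunk 14 of `rank5_all`: the sixty-four bit patterns `896` to `959` (kernel computation). -/
theorem rank5_chunk14 : ∀ n : Fin 64, ∃ v : Fin 5, (minor5 (bits10 (896 + n.val)) v).det ≠ 0 := by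
  decide +kernel

set_option maxRecDepth 100000 in
/-- Chunk 15 of `rank5_all`: the sixty-four bit patterns `960` to `1023` (kernel computation). -/
theorem rank5_chunk15 : ∀ n : Fin 64, ∃ v : Fin 5, (minor5 (bits10 (960 + n.val)) v).det ≠ 0 := by
  decide +kernel

set_option maxRecDepth 100000 in
/-- Every graph on four vertices has a nonsingular `3 × 3` principal submatrix of `2I + A`. -/
theorem rank4_all : ∀ b : Fin 6 → Bool, ∃ v : Fin 4, (minor4 b v).det ≠ 0 := by
  decide +kernel

set_option maxRecDepth 100000 in
/-- `2I + A` is nonsingular for every graph on three vertices. -/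
theorem rank3_all : ∀ b : Fin 3 → Bool, (full3 b).det ≠ 0 := by
  decide +kernel

/-- The chunks, assembled over `n < 1024`. -/
theorem rank5_bits : ∀ n : ℕ, n < 1024 → ∃ v : Fin 5, (minor5 (bits10 n) v).det ≠ 0 := by
  intro n hn
  have hq : n / 64 < 16 := by omega
  have hsplit : n = 64 * (n / 64) + n % 64 := (Nat.div_add_mod n 64).symm
  rw [hsplit]
  generalize hq' : n / 64 = q at hq
  interval_cases q
  · exact rank5_chunk0 ⟨n % 64, Nat.mod_lt _ (by norm_num)⟩
  · exact rank5_chunk1 ⟨n % 64, Nat.mod_lt _ (by norm_num)⟩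
  · exact rank5_chunk2 ⟨n % 64, Nat.mod_lt _ (by norm_num)⟩
  · exact rank5_chunk3 ⟨n % 64, Nat.mod_lt _ (by norm_num)⟩
  · exact rank5_chunk4 ⟨n % 64, Nat.mod_lt _ (by norm_num)⟩
  · exact rank5_chunk5 ⟨n % 64, Nat.mod_lt _ (by norm_num)⟩
  · exact rank5_chunk6 ⟨n % 64, Nat.mod_lt _ (by norm_num)⟩
  · exact rank5_chunk7 ⟨n % 64, Nat.mod_lt _ (by norm_num)⟩
  · exact rank5_chunk8 ⟨n % 64, Nat.mod_lt _ (by norm_num)⟩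
  · exact rank5_chunk9 ⟨n % 64, Nat.mod_lt _ (by norm_num)⟩
  · exact rank5_chunk10 ⟨n % 64, Nat.mod_lt _ (by norm_num)⟩
  · exact rank5_chunk11 ⟨n % 64, Nat.mod_lt _ (by norm_num)⟩
  · exact rank5_chunk12 ⟨n % 64, Nat.mod_lt _ (by norm_num)⟩
  · exact rank5_chunk13 ⟨n % 64, Nat.mod_lt _ (by norm_num)⟩
  · exact rank5_chunk14 ⟨n % 64, Nat.mod_lt _ (by norm_num)⟩
  · exact rank5_chunk15 ⟨n % 64, Nat.mod_lt _ (by norm_num)⟩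

/-- **Every graph on five vertices has a nonsingular `4 × 4` principal submatrix of `2I + A`.** -/
theorem rank5_all : ∀ b : Fin 10 → Bool, ∃ v : Fin 5, (minor5 b v).det ≠ 0 := by
  intro b
  rw [← bits10_pattern10 b]
  exact rank5_bits _ (pattern10_lt b)

/-! ### Every symmetric 0/1 matrix with zero diagonal is an `adj5` -/

/-- The edge indicator of a matrix. -/
def indOf (B : Matrix (Fin 5) (Fin 5) ℤ) : Fin 10 → Bool :=
  fun k => decide (B (edges5 k).1 (edges5 k).2 = 1)

/-- A symmetric 0/1 matrix with zero diagonal is the adjacency of its edge indicator. -/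
theorem adj5_indOf (B : Matrix (Fin 5) (Fin 5) ℤ) (hs : ∀ i j, B i j = B j i)
    (h01 : ∀ i j, i ≠ j → B i j = 0 ∨ B i j = 1) (hd : ∀ i, B i i = 0) :
    adj5 (indOf B) = B := by
  ext i j
  by_cases hij : i = j
  · subst hij; simp [adj5, hd]
  · rcases h01 i j hij with h0 | h1
    · have h0' : B j i = 0 := by rw [hs]; exact h0
      clear hs h01 hd
      fin_cases i <;> fin_cases j <;> simp_all [adj5, eidx5, indOf, edges5]
    · have h1' : B j i = 1 := by rw [hs]; exact h1
      clear hs h01 hd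
      fin_cases i <;> fin_cases j <;> simp_all [adj5, eidx5, indOf, edges5]

/-- The edge indicator of a `4 × 4` matrix. -/
def indOf4 (B : Matrix (Fin 4) (Fin 4) ℤ) : Fin 6 → Bool :=
  fun k => decide (B (edges4 k).1 (edges4 k).2 = 1)

/-- A symmetric 0/1 matrix with zero diagonal on four vertices is the adjacency of its edge indicator. -/
theorem adj4_indOf (B : Matrix (Fin 4) (Fin 4) ℤ) (hs : ∀ i j, B i j = B j i)
    (h01 : ∀ i j, i ≠ j → B i j = 0 ∨ B i j = 1) (hd : ∀ i, B i i = 0) :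
    adj4 (indOf4 B) = B := by
  ext i j
  by_cases hij : i = j
  · subst hij; simp [adj4, hd]
  · rcases h01 i j hij with h0 | h1
    · have h0' : B j i = 0 := by rw [hs]; exact h0
      clear hs h01 hd
      fin_cases i <;> fin_cases j <;> simp_all [adj4, eidx4, indOf4, edges4]
    · have h1' : B j i = 1 := by rw [hs]; exact h1
      clear hs h01 hd
      fin_cases i <;> fin_cases j <;> simp_all [adj4, eidx4, indOf4, edges4]

/-- The edge indicator of a `3 × 3` matrix. -/
def indOf3 (B : Matrix (Fin 3) (Fin 3) ℤ) : Fin 3 → Bool :=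
  fun k => decide (B (edges3 k).1 (edges3 k).2 = 1)

/-- A symmetric 0/1 matrix with zero diagonal on three vertices is the adjacency of its edge indicator. -/
theorem adj3_indOf (B : Matrix (Fin 3) (Fin 3) ℤ) (hs : ∀ i j, B i j = B j i)
    (h01 : ∀ i j, i ≠ j → B i j = 0 ∨ B i j = 1) (hd : ∀ i, B i i = 0) :
    adj3 (indOf3 B) = B := by
  ext i j
  by_cases hij : i = j
  · subst hij; simp [adj3, hd]
  · rcases h01 i j hij with h0 | h1
    · have h0' : B j i = 0 := by rw [hs]; exact h0
      clear hs h01 hd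
      fin_cases i <;> fin_cases j <;> simp_all [adj3, eidx3, indOf3, edges3]
    · have h1' : B j i = 1 := by rw [hs]; exact h1
      clear hs h01 hd
      fin_cases i <;> fin_cases j <;> simp_all [adj3, eidx3, indOf3, edges3]

end PercRepro
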